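import Literature.NumberTheory.QuadraticFields.BinaryQuadraticFormsClassNumberCountChunks
import HarnessLib

/-!
# Class numbers of imaginary quadratic discriminants at the bed's DEEP ladder rungs, part (d):
# `h(−51 599 563) = 487`

Topic `NumberTheory/QuadraticFields`, namespace `Literature.NumberTheory.QuadraticFields.Quadratic`; pure VALUES file (theorems
only): the form class number `BinQF.classNumber D = h(D)` of `BinaryQuadraticFormsClassNumber.lean` (Cox Thm. 2.13) at NEGATIVE deep
rungs of the landau-siegel rescue bed's least-all-inert ladder (bed-1 spec `bed1-KG1-v0.1`, list `L1y`: `D_y^−` = the negative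
fundamental discriminant of least absolute value with `χ_D(p) = −1` for every prime `p ≤ y`; Lehmer–Lehmer–Shanks 1970), by the pair
counter of `BinaryQuadraticFormsClassNumberCount.lean` (Cohen's Algorithm 5.3.5, `BinQF.classNumber_eq_classNumberCount`). One
`decide +kernel` declaration carries ≈ 1.2·10⁷ pair tests of that counter before the kernel's share of the heartbeat budget is spent
(`N ≈ 1.4·10⁷`), so here the row range `1 ≤ a ≤ ⌊√(N/3)⌋` is cut into chunks of roughly equal work (`BinQF.redRowsSumFrom`,
`BinaryQuadraticFormsClassNumberCountChunks.lean`), each certified in its own declaration, and the chunk values are added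
(`BinQF.redRowsSumFrom_add`, `BinQF.classNumberCount_eq_redRowsSumFrom`). The values agree with the bed's two engine lineages
(A = PARI `quadclassunit`, B = reduced forms; referee join `kg1deep`, column `G01_h` exact).

| `D` | factorisation | `h(D)` | ladder rung | chunks |
|---|---|---|---|---|
| `−51 599 563` | prime | `487` | `D_71^−` | 7 |

First consumer: `Zhang2022/RepairBedClassNumberFormulaNegDeep.lean` (`L(1, χ_D) = πh/√|D|`).

## References

* [Cox2013] D. A. Cox, *Primes of the form x² + ny²*, 2nd ed. (2013), §2.A Thm. 2.8, Thm. 2.13.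
* [Cohen1993] H. Cohen, *A Course in Computational Algebraic Number Theory*, GTM 138, §5.3.1 Algorithm 5.3.5.
* [LehmerLehmerShanks1970] D. H. Lehmer, E. Lehmer, D. Shanks, *Integer sequences having prescribed quadratic character*,
  Math. Comp. 24 (1970) 433–451, §1 and Table.
-/

namespace Literature.NumberTheory.QuadraticFields.Quadratic

/-- Row chunk `a ∈ (0, 1567]` of Cohen's Algorithm 5.3.5 at `N = 51 599 563`: partial count `229` (one kernel evaluation).
[cite: Cohen1993, §5.3.1 Algorithm 5.3.5] -/
theorem redRowsSumFrom_51599563_0 : BinQF.redRowsSumFrom 51599563 0 1567 = 229 := by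
  decide +kernel

/-- Row chunk `a ∈ (1567, 2217]` of Cohen's Algorithm 5.3.5 at `N = 51 599 563`: partial count `64` (one kernel evaluation).
[cite: Cohen1993, §5.3.1 Algorithm 5.3.5] -/
theorem redRowsSumFrom_51599563_1567 : BinQF.redRowsSumFrom 51599563 1567 650 = 64 := by
  decide +kernel

/-- Row chunk `a ∈ (2217, 2715]` of Cohen's Algorithm 5.3.5 at `N = 51 599 563`: partial count `66` (one kernel evaluation).
[cite: Cohen1993, §5.3.1 Algorithm 5.3.5] -/
theorem redRowsSumFrom_51599563_2217 : BinQF.redRowsSumFrom 51599563 2217 498 = 66 := by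
  decide +kernel

end Literature.NumberTheory.QuadraticFields.Quadratic
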